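import Literature.Probability.LatticeModels.PinningAnchoring
import Literature.Probability.LatticeModels.GoodAboveFromPinning
import Literature.Probability.LatticeModels.OrientationReflect
import Literature.Probability.LatticeModels.CoexistenceTransport
import Literature.Probability.LatticeModels.IsingGibbsFlip
import Literature.Probability.LatticeModels.ReflectionInvarianceStep
import HarnessLib

/-!
# Anchoring of the four pinning structures in the coexistence case (GH2000 Lemma 5.5, Case 3)

Topic `Probability/LatticeModels`; theorems only. In Case 3 of the proof of Georgii–Higuchi's
Lemma 5.5 the pinning lemma (Lemma 5.2) is applied four ways: `x` on the left is pinned by `+`sites of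
the second layer or by `-`sites of the first, `y` on the right by `-`sites of the first layer or by
`+`sites of the second ("for definiteness … the alternative case is analogous"). The hypothesis of
the pinning lemma, in the form `LeftAnchoredInf m` of `PinningLemma`/`PinningAnchoring` (the
infinite structure `J` touches the left half-axis unboundedly far away), is established in
`PinningAnchoring.ae_leftAnchoredInf` for the basic case. Here we transport it to the three
mirror images used by `GoodAboveFromPinning` (`PinLeft m x (-ω)`, `PinRightMinus = PinLeft ∘ negRefl`,
`PinRightPlus = PinLeft ∘ refl0`), from the orientation of the interface:

* `ae_leftAnchoredInf_neg` — for `-ω`, from a `-∗`cluster with axis sites unbounded below and an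
  infinite `+`cluster of `π_up` (global flip);
* `ae_leftAnchoredInf_refl0` — for `ω ∘ R₀`, from a `+∗`cluster with axis sites unbounded above and
  an infinite `-`cluster (reflection `x₁ ↦ -x₁`);
* `ae_leftAnchoredInf_negRefl` — for `-ω ∘ R₀`, from a `-∗`cluster with axis sites unbounded above
  and an infinite `+`cluster;
* `ae_minusStar_axisUnboundedAbove_of_left`, `ae_minusStar_axisUnboundedBelow_of_right` — the
  `-∗`inputs from the orientation of the `+∗`cluster (sides lemma, `CoexistenceTransport`).

## References

* H.-O. Georgii, Y. Higuchi, J. Math. Phys. 41 (2000) 1153–1169, Lemma 5.2 (hypothesis) and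
  Lemma 5.5 (proof, Case 3) [GeorgiiHiguchi2000].
-/

noncomputable section

open MeasureTheory Filter SimpleGraph
open Literature.Probability.Percolation
open scoped ENNReal

namespace Literature.Probability.LatticeModels

section Anchoring

variable {β : ℝ} {μ : Measure (SpinConfig (Site 2))}

/-- Axis sites of `s∗`clusters of the upper half-plane under `x₁ ↦ -x₁` (any sign). [folklore] -/
theorem mem_starCluster_refl0_iff (s : ℤˣ) (ω : SpinConfig (Site 2)) (x : Site 2) (k : ℤ) :
    (![k, 0] : Site 2) ∈ siteCluster zdStarGraph (spinSites s (refl0 ω) ∩ halfPlane 0) x ↔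
      (![-k, 0] : Site 2) ∈ siteCluster zdStarGraph (spinSites s ω ∩ halfPlane 0) (reflectCoord 0 x) := by
  let φ : zdStarGraph ≃g zdStarGraph :=
    { toEquiv := (reflectCoord (d := 2) 0).toEquiv
      map_rel_iff' := by
        intro a b
        constructor
        · intro h
          have h' := (starReflectHom 0).map_rel h
          rw [starReflectHom_apply, starReflectHom_apply] at h'
          have ea : reflectCoord 0 ((reflectCoord (d := 2) 0).toEquiv a) = a := reflectCoord_reflectCoord 0 a
          have eb : reflectCoord 0 ((reflectCoord (d := 2) 0).toEquiv b) = b := reflectCoord_reflectCoord 0 b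
          rw [ea, eb] at h'
          exact h'
        · intro h
          exact (starReflectHom 0).map_rel h }
  have hφ1 : ∀ z : Site 2, (φ z) 1 = z 1 := fun z => (reflectCoord_zero_apply z).2
  have hO : spinSites s (refl0 ω) ∩ halfPlane 0 = (φ : Site 2 → Site 2) '' (spinSites s ω ∩ halfPlane 0) := by
    rw [show refl0 ω = configRelabel φ.toEquiv ω from rfl, spinSites_configRelabel, image_reflectZero_inter_halfPlane φ hφ1]
    rfl
  have key : siteCluster zdStarGraph ((φ : Site 2 → Site 2) '' (spinSites s ω ∩ halfPlane 0)) (φ (reflectCoord 0 x)) =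
      (φ : Site 2 → Site 2) '' siteCluster zdStarGraph (spinSites s ω ∩ halfPlane 0) (reflectCoord 0 x) := by
    have h := siteCluster_relabel φ (spinSites s ω ∩ halfPlane 0) (reflectCoord 0 x)
    rwa [SiteConfig.relabel_apply] at h
  have hx : φ (reflectCoord 0 x) = x := reflectCoord_reflectCoord 0 x
  have hk : (![k, 0] : Site 2) = φ (![-k, 0]) := by
    show (![k, 0] : Site 2) = reflectCoord 0 ![-k, 0]
    funext j; rw [reflectCoord_apply]; fin_cases j <;> simp
  conv_lhs => rw [hO, ← hx, key]
  rw [hk]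
  exact ⟨fun h => by
    obtain ⟨z, hz, hzk⟩ := h
    have : z = ![-k, 0] := φ.injective hzk
    rwa [this] at hz, fun h => Set.mem_image_of_mem _ h⟩

/-- **Anchoring for the flipped configuration**: if almost surely a `-∗`cluster of `π_up` has axis
sites unbounded below and `π_up` contains an infinite `+`cluster, then `LeftAnchoredInf m (-ω)`
almost surely. [cite: GeorgiiHiguchi2000, Lemma 5.5 (proof, Case 3: "pin `x` by `-`sites")] -/
theorem ae_leftAnchoredInf_neg (hβc : criticalBeta 2 < β) (hμ : μ ∈ isingGibbsMeasures 2 β 0) (m : ℕ)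
    (hL : ∀ᵐ ω ∂μ, ∃ x, ∀ n : ℕ, ∃ k : ℤ, k < -(n : ℤ) ∧
      (![k, 0] : Site 2) ∈ siteCluster zdStarGraph (spinSites (-1) ω ∩ halfPlane 0) x)
    (hP : ∀ᵐ ω ∂μ, ∃ y, (siteCluster (zdGraph 2) (spinSites 1 ω ∩ halfPlane 0) y).Infinite) :
    ∀ᵐ ω ∂μ, LeftAnchoredInf m (-ω) := by
  classical
  have hμG : IsGibbsMeasure (isingSpecification (zdGraph 2) β 0) μ := hμ
  haveI := hμG.isProbabilityMeasure
  have hnm : Measurable (fun σ : SpinConfig (Site 2) => -σ) := measurable_neg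
  set μn : Measure (SpinConfig (Site 2)) := μ.map (fun σ : SpinConfig (Site 2) => -σ) with hμn
  have hμnG : μn ∈ isingGibbsMeasures 2 β 0 := isGibbsMeasure_map_neg (zdGraph 2) β hμG
  have hL' : ∀ᵐ ω ∂μn, ∃ x, ∀ n : ℕ, ∃ k : ℤ, k < -(n : ℤ) ∧
      (![k, 0] : Site 2) ∈ siteCluster zdStarGraph (spinSites 1 ω ∩ halfPlane 0) x := by
    rw [hμn, ae_map_iff hnm.aemeasurable (measurableSet_axisUnboundedBelow_config (G := zdStarGraph) 1 (halfPlane 0))]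
    filter_upwards [hL] with ω hω
    simpa only [spinSites_neg_config] using hω
  have hC' : ∀ᵐ ω ∂μn, ∃ y, (siteCluster (zdGraph 2) (spinSites (-1) ω ∩ halfPlane 0) y).Infinite := by
    rw [hμn, ae_map_iff hnm.aemeasurable (MeasurableSet.of_tailEvents
      (measurableSet_tailEvents_existsInfClusterIn (G := zdGraph 2) (-1) (halfPlane 0)))]
    filter_upwards [hP] with ω hω
    show ∃ y, (siteCluster (zdGraph 2) (spinSites (-1) (-ω) ∩ halfPlane 0) y).Infinite
    simpa only [spinSites_neg_config, neg_neg] using hω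
  have key := ae_leftAnchoredInf hβc hμnG m hL' hC'
  rw [hμn, ae_map_iff hnm.aemeasurable (measurableSet_leftAnchoredInf (m := m))] at key
  exact key

/-- **Anchoring for the reflected configuration `ω ∘ R₀`**: if almost surely a `+∗`cluster of
`π_up` has axis sites unbounded above and `π_up` contains an infinite `-`cluster, then
`LeftAnchoredInf m (refl0 ω)` almost surely. [cite: GeorgiiHiguchi2000, Lemma 5.5 (proof, Case 3: "pin `y` by `+`sites")] -/
theorem ae_leftAnchoredInf_refl0 (hβc : criticalBeta 2 < β) (hμ : μ ∈ isingGibbsMeasures 2 β 0) (m : ℕ)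
    (hR : ∀ᵐ ω ∂μ, ∃ x, ∀ n : ℕ, ∃ k : ℤ, (n : ℤ) < k ∧
      (![k, 0] : Site 2) ∈ siteCluster zdStarGraph (spinSites 1 ω ∩ halfPlane 0) x)
    (hM : ∀ᵐ ω ∂μ, ∃ y, (siteCluster (zdGraph 2) (spinSites (-1) ω ∩ halfPlane 0) y).Infinite) :
    ∀ᵐ ω ∂μ, LeftAnchoredInf m (refl0 ω) := by
  classical
  have hμG : IsGibbsMeasure (isingSpecification (zdGraph 2) β 0) μ := hμ
  haveI := hμG.isProbabilityMeasure
  have hρm : Measurable (refl0 : SpinConfig (Site 2) → SpinConfig (Site 2)) := measurable_refl0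
  set μR : Measure (SpinConfig (Site 2)) := μ.map refl0 with hμR
  have hμRG : μR ∈ isingGibbsMeasures 2 β 0 := IsGibbsMeasure.map_configRelabel _ (reflectCoord 0) hμG
  have hφ1 : ∀ z : Site 2, ((reflectCoord (d := 2) 0) z) 1 = z 1 := fun z => (reflectCoord_zero_apply z).2
  have hL' : ∀ᵐ ω ∂μR, ∃ x, ∀ n : ℕ, ∃ k : ℤ, k < -(n : ℤ) ∧
      (![k, 0] : Site 2) ∈ siteCluster zdStarGraph (spinSites 1 ω ∩ halfPlane 0) x := by
    rw [hμR, ae_map_iff hρm.aemeasurable (measurableSet_axisUnboundedBelow_config (G := zdStarGraph) 1 (halfPlane 0))]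
    filter_upwards [hR] with ω ⟨x₀, hx₀⟩
    refine ⟨reflectCoord 0 x₀, fun n => ?_⟩
    obtain ⟨k, hk, hmem⟩ := hx₀ n
    refine ⟨-k, by omega, ?_⟩
    rw [mem_starCluster_refl0_iff, neg_neg, reflectCoord_reflectCoord]
    exact hmem
  have hC' : ∀ᵐ ω ∂μR, ∃ y, (siteCluster (zdGraph 2) (spinSites (-1) ω ∩ halfPlane 0) y).Infinite := by
    rw [hμR, ae_map_iff hρm.aemeasurable (MeasurableSet.of_tailEvents
      (measurableSet_tailEvents_existsInfClusterIn (G := zdGraph 2) (-1) (halfPlane 0)))]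
    filter_upwards [hM] with ω ⟨y₀, hy₀⟩
    refine ⟨reflectCoord 0 y₀, ?_⟩
    exact (infinite_siteCluster_configRelabel_iff (reflectCoord (d := 2) 0) hφ1 (-1) ω y₀).2 hy₀
  have key := ae_leftAnchoredInf hβc hμRG m hL' hC'
  rw [hμR, ae_map_iff hρm.aemeasurable (measurableSet_leftAnchoredInf (m := m))] at key
  exact key

/-- **Anchoring for `-ω ∘ R₀`** (the structure pinning `y` by `-`sites on the right): if almost
surely a `-∗`cluster of `π_up` has axis sites unbounded above and `π_up` contains an infinite
`+`cluster, then `LeftAnchoredInf m (negRefl ω)` almost surely. [cite: GeorgiiHiguchi2000, Lemma 5.5 (proof, Case 3: "`y` is `-∗`connected off `Δ` to `I^-_up(ω)`")] -/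
theorem ae_leftAnchoredInf_negRefl (hβc : criticalBeta 2 < β) (hμ : μ ∈ isingGibbsMeasures 2 β 0) (m : ℕ)
    (hR : ∀ᵐ ω ∂μ, ∃ x, ∀ n : ℕ, ∃ k : ℤ, (n : ℤ) < k ∧
      (![k, 0] : Site 2) ∈ siteCluster zdStarGraph (spinSites (-1) ω ∩ halfPlane 0) x)
    (hP : ∀ᵐ ω ∂μ, ∃ y, (siteCluster (zdGraph 2) (spinSites 1 ω ∩ halfPlane 0) y).Infinite) :
    ∀ᵐ ω ∂μ, LeftAnchoredInf m (negRefl ω) := by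
  classical
  have hμG : IsGibbsMeasure (isingSpecification (zdGraph 2) β 0) μ := hμ
  haveI := hμG.isProbabilityMeasure
  have hρm : Measurable (refl0 : SpinConfig (Site 2) → SpinConfig (Site 2)) := measurable_refl0
  set μR : Measure (SpinConfig (Site 2)) := μ.map refl0 with hμR
  have hμRG : μR ∈ isingGibbsMeasures 2 β 0 := IsGibbsMeasure.map_configRelabel _ (reflectCoord 0) hμG
  have hφ1 : ∀ z : Site 2, ((reflectCoord (d := 2) 0) z) 1 = z 1 := fun z => (reflectCoord_zero_apply z).2
  -- hypotheses for `μ ∘ R₀⁻¹`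
  have hL' : ∀ᵐ ω ∂μR, ∃ x, ∀ n : ℕ, ∃ k : ℤ, k < -(n : ℤ) ∧
      (![k, 0] : Site 2) ∈ siteCluster zdStarGraph (spinSites (-1) ω ∩ halfPlane 0) x := by
    rw [hμR, ae_map_iff hρm.aemeasurable (measurableSet_axisUnboundedBelow_config (G := zdStarGraph) (-1) (halfPlane 0))]
    filter_upwards [hR] with ω ⟨x₀, hx₀⟩
    refine ⟨reflectCoord 0 x₀, fun n => ?_⟩
    obtain ⟨k, hk, hmem⟩ := hx₀ n
    refine ⟨-k, by omega, ?_⟩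
    rw [mem_starCluster_refl0_iff, neg_neg, reflectCoord_reflectCoord]
    exact hmem
  have hP' : ∀ᵐ ω ∂μR, ∃ y, (siteCluster (zdGraph 2) (spinSites 1 ω ∩ halfPlane 0) y).Infinite := by
    rw [hμR, ae_map_iff hρm.aemeasurable (MeasurableSet.of_tailEvents
      (measurableSet_tailEvents_existsInfClusterIn (G := zdGraph 2) 1 (halfPlane 0)))]
    filter_upwards [hP] with ω ⟨y₀, hy₀⟩
    refine ⟨reflectCoord 0 y₀, ?_⟩
    exact (infinite_siteCluster_configRelabel_iff (reflectCoord (d := 2) 0) hφ1 1 ω y₀).2 hy₀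
  have key := ae_leftAnchoredInf_neg hβc hμRG m hL' hP'
  rw [hμR, ae_map_iff hρm.aemeasurable] at key
  · filter_upwards [key] with ω hω
    rw [negRefl_eq_refl0_neg]
    have : refl0 (-ω) = -refl0 ω := by funext z; simp
    rw [this]; exact hω
  · exact measurable_neg (measurableSet_leftAnchoredInf (m := m))

/-- **Orientation input, left**: with the `+`face on the left, a `-∗`cluster of `π_up` has axis
sites unbounded above (the infinite `-`cluster lies right of the `+∗`cluster). [cite: GeorgiiHiguchi2000, Lemma 5.5 (proof, Case 3)] -/
theorem ae_minusStar_axisUnboundedAbove_of_left (hβc : criticalBeta 2 < β) (hμ : μ ∈ isingGibbsMeasures 2 β 0)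
    (hL : ∀ᵐ ω ∂μ, ∃ x, ∀ n : ℕ, ∃ k : ℤ, k < -(n : ℤ) ∧
      (![k, 0] : Site 2) ∈ siteCluster zdStarGraph (spinSites 1 ω ∩ halfPlane 0) x)
    (hM : ∀ᵐ ω ∂μ, ∃ y, (siteCluster (zdGraph 2) (spinSites (-1) ω ∩ halfPlane 0) y).Infinite) :
    ∀ᵐ ω ∂μ, ∃ x, ∀ n : ℕ, ∃ k : ℤ, (n : ℤ) < k ∧
      (![k, 0] : Site 2) ∈ siteCluster zdStarGraph (spinSites (-1) ω ∩ halfPlane 0) x := by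
  filter_upwards [ae_minus_axisUnboundedAbove_of_plusStar_below hβc hμ hL hM] with ω ⟨y, hy⟩
  refine ⟨y, fun n => ?_⟩
  obtain ⟨k, hk, hmem⟩ := hy n
  exact ⟨k, hk, siteCluster_zd_subset_star _ y hmem⟩

/-- **Orientation input, right**: with the `+`face on the right, a `-∗`cluster of `π_up` has axis
sites unbounded below. [cite: GeorgiiHiguchi2000, Lemma 5.5 (proof, Case 3)] -/
theorem ae_minusStar_axisUnboundedBelow_of_right (hβc : criticalBeta 2 < β) (hμ : μ ∈ isingGibbsMeasures 2 β 0)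
    (hR : ∀ᵐ ω ∂μ, ∃ x, ∀ n : ℕ, ∃ k : ℤ, (n : ℤ) < k ∧
      (![k, 0] : Site 2) ∈ siteCluster zdStarGraph (spinSites 1 ω ∩ halfPlane 0) x)
    (hM : ∀ᵐ ω ∂μ, ∃ y, (siteCluster (zdGraph 2) (spinSites (-1) ω ∩ halfPlane 0) y).Infinite) :
    ∀ᵐ ω ∂μ, ∃ x, ∀ n : ℕ, ∃ k : ℤ, k < -(n : ℤ) ∧
      (![k, 0] : Site 2) ∈ siteCluster zdStarGraph (spinSites (-1) ω ∩ halfPlane 0) x := by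
  filter_upwards [ae_minus_axisUnboundedBelow_of_plusStar_above hβc hμ hR hM] with ω ⟨y, hy⟩
  refine ⟨y, fun n => ?_⟩
  obtain ⟨k, hk, hmem⟩ := hy n
  exact ⟨k, hk, siteCluster_zd_subset_star _ y hmem⟩

end Anchoring

end Literature.Probability.LatticeModels
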